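import Literature.NumberTheory.EllipticCurves.PointCountEulerCriterion
import Summits.BirchSwinnertonDyer.Rank1Residual.X10.CasselsTatePairingCertificate
import Summits.BirchSwinnertonDyer.Rank1Residual.X11b.ChaPairsMinimality
import Summits.BirchSwinnertonDyer.Rank1Residual.Supersingular.DescentLowerBound
import Summits.BirchSwinnertonDyer.BirchSwinnertonDyer.Theorems.Rank1ResidualX11RankOneReduction
import HarnessLib

/-!
# The SECOND 3-DESCENT (9-descent) certificate shape: "no non-zero class of `Ш(E/ℚ)[3]` is divisible by `3`" ⇒ `Ш[9] = Ш[3]` ⇒ `BSD(E,3)` at a rank-`0` pair with `#Sel^(3) = 9`, `ord₃ #Ш_an = 2` — PAIRING-FREE, IMAGE-FREE (cell `b2b-bsdres`, unit `b2b-bsdres-x10`, gen 45)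

HONEST FRAMING (run/shared/lean/b2b/bsd-rank1-residual/, verbatim in every file): the goal of the
cell is to DELETE the COMBINATION-SHAPED residual classes of the Birch–Swinnerton-Dyer formula for
ALL analytic-rank `≤ 1` elliptic curves over `ℚ` — "full BSD formula for every rank `≤ 1` curve in
class `C`" assembled STRICTLY from published theorems — so that the rank-`≤ 1` remainder becomes
exactly the CONSTRUCTION-SHAPED classes, which are TYPED (missing-input `Prop`s), NOT attempted.
This is not "finishing BSD". Theorems only (no definition, no new named fact); NOTHING IS BOOKED
here; no class label changes (X10b stays CONSTRUCTION-SHAPED / NEEDS X_A3). Per pair.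

**What this file is.** Route A of the cell's CTP-on-Sel³ instrument (Fisher–Newton's formula) certifies
the Cassels–Tate GRAM MATRIX on `Sel^(3) ≅ Ш[3]` and the kernel turns "alternating, non-zero" into
`Ш[9] = Ш[3]` (`X10/CasselsTatePairingGram`); for the seven rank-`0` N2 Ш-cells with mod-`3` image `3Nn`
(normaliser of a NON-split Cartan: `24649b1 174887i1 264992dm1 288800ba1 307520ca1 323008bo1 453152bq1`,
`#Ш_an = 9`, `dim_𝔽₃ Sel^(3) = 2` two-engine) route A has NO document: the `3`-torsion field is OCTIC with
`|d| ≥ 8·10¹¹` and the norm-equation step does not terminate (X10-AUDIT §24, §50.3; Fisher–Newton 2014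
p. 15 "only practical if the discriminant is sufficiently small"). ROUTE C9 (x10 GEN 45) replaces the
pairing by a SECOND 3-DESCENT on each non-trivial `3`-covering: for a plane cubic `C` with
`[C] = η ∈ Sel^(3)(E/ℚ) = Ш(E/ℚ)[3]` (rank `0`, `E(ℚ)[3] = 0`), B. Creutz, *Second p-descents on elliptic
curves*, Math. Comp. 83 (2014), Thm. 5.2 / Lemma 5.10 / Lemma 7.6 / Prop. 7.7 / Algorithm 7.3 (`p = 3`,
`k = ℚ`) give, for the FLEX ALGEBRA `F` of `C` (the étale algebra of its nine flex points, here a number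
field of degree `9`), the tangent form `ℓ̃₁` at the generic flex, the constant `c ∈ ℚ×` with
`N_{F/ℚ}(ℓ̃₁) = c·Hess(C)³` on `C`, and the finite set `S` of primes (`2, 3`, bad for `C`, dividing `c`,
bad for `ℓ̃₁`): every everywhere-locally-soluble `3`-covering of `C` (= `9`-covering of `E` LIFTING `η`)
has an invariant `δ ∈ F(S,3)/ℚ×` with `N(δ) ≡ c (mod ℚ×³)` and `res_v δ` in the image of `C(ℚ_v)` for
every `v ∈ S`. These are finitely many AFFINE `𝔽₃`-linear conditions; if they are INCONSISTENT the
`3`-Selmer SET of `C` is EMPTY, i.e. `η ∉ 3·Sel^(9)(E/ℚ) = 3·Ш[9]`, i.e. `η` is NOT divisible by `3` in `Ш`.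
Run on the FOUR lines `⟨η₁⟩, ⟨η₂⟩, ⟨η₁+η₂⟩, ⟨η₁−η₂⟩` of `Ш[3] ≅ (ℤ/3)²` this says: NO non-zero
`3`-torsion class of `Ш` is of the form `3z` — which is LITERALLY `Ш[9] = Ш[3]` (if `9z = 0` then
`3z ∈ Ш[3]` is divisible by `3`, so `3z = 0`): §1 below, one line, for ANY additive group. Hence
`#Ш[3^∞] = #Ш[3] = #Sel^(3) = 9 = 3^{ord₃ #Ш_an}` and Miller's `BSD(E,3)` by p213922's
`bsdp_of_shaNoPSqTorsion_of_card_selmerGroup` (Gross–Zagier–Kolyvagin for rank and finiteness; Mazur for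
`3 ∤ #E(ℚ)_tors` from `E[3]` irreducible): NO Cassels–Tate pairing (not even its existence), NO Iwasawa
theory, NO Kato / F1 input, NO image hypothesis, NO Heegner index. §2 is that composition (any `p`, any
`#Sel^(p) = p^m`); §3 the record shape for a literal integer model with `E[3]` irreducible decided in the
kernel from one Frobenius point count (as `X10/CasselsTatePairingRecords` §1).

**The one binder the certificate discharges** is `h9 : ∀ x : Ш(E/ℚ), 3 • x = 0 → x ≠ 0 → ∀ z, 3 • z ≠ x`.
Per curve it is the content of FOUR route-C9 documents (one per line of `Sel^(3)`), each the verdict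
"INCONSISTENT ⇒ Sel^(3)(C) = ∅" of TWO engines written apart — engine 1 `ninedesc.gp` (PARI/GP:
Poonen–Schaefer `F(S,3)` with `bnfcertify = 1` and a full-rank cube-residue character matrix, local
cube classes by `idealstar`/residue symbols, local images by sampling and, where the sampled affine
dimension stays below `dim E(ℚ_v)/3E(ℚ_v)`, by EXHAUSTIVE enumeration of the solution classes of `C` in
`P²(ℤ/v^n)` refined until the cube class of `ℓ̃₁` is constant on each class — a certified SUPERSET of the
image) and engine 2 `ninedesc_e2.py` (SageMath: `Jacobian` by the Aronhold invariants, `selmer_space`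
— class group under GRH (`proof.number_field(False)`), its dimension cross-checked against engine 1's
certified bound `R`; Singular ideal membership for `c`, its own samplers and local maps; the
method-disjoint corroboration, engine 1 being the unconditional leg) — plus the
cubics' provenance (route A stage A3 on x10b's/x11b's two-engine Selmer bases, `JOB_LINES4` frame
`η₁, η₂, η₁η₂, η₁η₂²`; Jacobian `≅ E` over `ℚ` re-decided by both engines) and the two-engine `#Sel^(3) = 9`
line (`hcard`). Instrument-level controls (curves where the answer is a THEOREM: the fourteen `3Ns`
cells with a verified non-degenerate CTP ⇒ every line EMPTY; `384400cx1` with `#Ш = 81 = #Ш[9]`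
PROVED (R766) and rank-`1` curves with `C(ℚ) ≠ ∅` ⇒ NEVER empty) certify the instrument, not the cells.
The referee prices all of this; these theorems book nothing.

References: B. Creutz, Math. Comp. 83 (2014) 365–409, Thm. 5.2, Lemma 5.10, Lemma 7.6, Prop. 7.7,
Alg. 7.3 [Creutz2014]; R. L. Miller, LMS J. Comput. Math. 14 (2011) Def. 1.1 [Miller2011LMS]; B. Mazur,
Invent. Math. 44 (1978) Prop. 6.3 (1) [Mazur1978]; Silverman AEC Thm. X.4.2 (a) [SilvermanAEC2009];
companions `X10/CasselsTatePairingCertificate` (p213922), `X10/CasselsTatePairingGram`,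
`X10/CasselsTatePairingRecords` §1; cell files X10-AUDIT.md §51, `HOME/b2b-bsdres-x10/g45/c9/`.
-/

set_option autoImplicit false

noncomputable section

open scoped Classical

open WeierstrassCurve Literature.NumberTheory.EllipticCurves
  Literature.NumberTheory.EllipticCurves.Rank1Residual
  Literature.NumberTheory.EllipticCurves.Rank1Residual.Typed
  Literature.NumberTheory.EllipticCurves.Rank1Residual.X11RankOneCertificates
  Summit.BirchSwinnertonDyer.BirchSwinnertonDyer.Rank1Residual.IntModel
  Summit.BirchSwinnertonDyer.BirchSwinnertonDyer.Rank1Residual.X11RankOne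
  Summit.BirchSwinnertonDyer.Rank1Residual.X11b

namespace Summit.BirchSwinnertonDyer.Rank1Residual.X10

/-! ### §1 Algebra: "no non-zero `n`-torsion element is an `n`-th multiple" is `A[n²] = A[n]` -/

section Algebra

variable {A : Type*} [AddCommGroup A]

/-- **No non-zero `n`-torsion class is divisible by `n` ⇒ `A[n²] = A[n]`**, for ANY additive group: if
`n² • x = 0` then `n • x` is an `n`-torsion element of the form `n • z` (`z = x`), so it is `0`. This is
the whole group theory behind a second `p`-descent certificate of EMPTINESS (Creutz 2014 §1: the
`p`-Selmer set of `C` is the fibre of `Sel^(p²) → Sel^(p)` over `[C]`). [cite: Creutz2014, §1 and Thm. 7.2] -/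
theorem sq_nsmul_stable_of_no_divisible_torsion {n : ℕ}
    (h : ∀ x : A, n • x = 0 → x ≠ 0 → ∀ z : A, n • z ≠ x) :
    ∀ x : A, n ^ 2 • x = 0 → n • x = 0 := by
  intro x hx
  by_contra hne
  have hn : n • (n • x) = 0 := by rw [← mul_smul, ← pow_two]; exact hx
  exact h (n • x) hn hne x rfl

/-- Conversely `A[n²] = A[n]` ⇒ no non-zero `n`-torsion class is an `n`-th multiple (so the binder of §2 is
EQUIVALENT to `Ш[9] = Ш[3]`, neither weaker nor stronger). [folklore] -/
theorem no_divisible_torsion_of_sq_nsmul_stable {n : ℕ}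
    (h : ∀ x : A, n ^ 2 • x = 0 → n • x = 0) :
    ∀ x : A, n • x = 0 → x ≠ 0 → ∀ z : A, n • z ≠ x := by
  intro x hx hne z hz
  apply hne
  rw [← hz]
  apply h
  rw [pow_two, mul_smul, hz, hx]

end Algebra

/-! ### §2 Over `ℚ`: Miller's `BSD(E,p)` from GZK + `#Sel^(p) = p^m` + the second-descent binder -/

section OverQ

variable (W : WeierstrassCurve ℚ) [W.IsElliptic] (p : ℕ) [Fact p.Prime]

/-- **`BSD(E,p)` at a rank-`0` pair from the `p`-descent count and the SECOND-`p`-DESCENT binder.**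
`E/ℚ` of analytic rank `0` (Gross–Zagier–Kolyvagin `hGZK`), `p ∤ #E(ℚ)_tors`, `#Sel^(p)(E/ℚ) = p^m` (two
descent engines), NO non-zero `p`-torsion class of `Ш(E/ℚ)` divisible by `p` (`h9`: for `p = 3` the four
route-C9 documents of the curve), and `ord_p #Ш_an = m` ⇒ Miller's `BSD(E,p)`. Class-free, image-free,
pairing-free; per curve. [cite: Creutz2014, Thm. 7.2 and Alg. 7.3] [cite: Miller2011LMS, §1 and Def. 1.1]
[cite: SilvermanAEC2009, Thm X.4.2(a)] -/
theorem bsdp_of_noDivisibleTorsion_of_card_selmerGroup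
    (hGZK : rank_eq_analyticRank_of_analyticRank_le_one) (hr : W.analyticRank = 0)
    (htors : ¬ p ∣ W.torsionOrder) {m : ℕ} (hcard : Nat.card (W.selmerGroup (p : ℤ)) = p ^ m)
    (h9 : ∀ x : W.sha, p • x = 0 → x ≠ 0 → ∀ z : W.sha, p • z ≠ x)
    {q : ℚ} (hq : shaAn W = (q : ℂ)) (hv : padicValRat p q = m) : BSDp W p :=
  bsdp_of_shaNoPSqTorsion_of_card_selmerGroup W p hGZK hr htors hcard
    (sq_nsmul_stable_of_no_divisible_torsion h9) hq hv

/-- **The exact `p`-part under the same data, no analytic `Ш` value needed: `ord_p #Ш(E/ℚ) = m`.**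
[cite: Creutz2014, Thm. 7.2] [cite: SilvermanAEC2009, Thm X.4.2(a)] -/
theorem padicValNat_shaOrder_eq_of_noDivisibleTorsion_of_card_selmerGroup
    (hGZK : rank_eq_analyticRank_of_analyticRank_le_one) (hr : W.analyticRank = 0)
    (htors : ¬ p ∣ W.torsionOrder) {m : ℕ} (hcard : Nat.card (W.selmerGroup (p : ℤ)) = p ^ m)
    (h9 : ∀ x : W.sha, p • x = 0 → x ≠ 0 → ∀ z : W.sha, p • z ≠ x) :
    padicValNat p W.shaOrder = m :=
  padicValNat_shaOrder_eq_of_shaNoPSqTorsion_of_card_selmerGroup W p hGZK hr htors hcard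
    (sq_nsmul_stable_of_no_divisible_torsion h9)

end OverQ

/-! ### §3 The record shape for a literal integer model at `p = 3` (class-free; `E[3]` irreducible kernel-decided) -/

/-- **`BSD(E,3)` from the literal model + `#Sel^(3) = 9` + the four second-3-descent documents.** For a
globally minimal `W` with integral model `[a₁,…,a₆]`: a good prime `ℓ ≠ 3` with `#Ẽ(𝔽_ℓ) = n` and
`X² − (ℓ+1−n)X + ℓ` root-free mod `3` gives `E[3]` irreducible (Mazur), hence `3 ∤ #E(ℚ)_tors`; with
`r_an = 0`, `#Sel^(3)(E/ℚ) = 9`, NO non-zero class of `Ш[3]` divisible by `3` (`h9`) and `ord₃ #Ш_an = 2`,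
§2 gives `BSD(E,3)`. Per pair; not a class theorem; books nothing. [cite: Creutz2014, Thm. 7.2 and Alg. 7.3]
[cite: Miller2011LMS, Def. 1.1] [cite: Mazur1978, §6 Prop. 6.3 (1) (p. 153)] [cite: SilvermanAEC2009, Thm X.4.2(a)] -/
theorem bsdp_three_of_ainvs_of_noDivisibleTorsion
    (hGZK : rank_eq_analyticRank_of_analyticRank_le_one)
    (a1 a2 a3 a4 a6 : ℤ) {W : WeierstrassCurve ℚ} [W.IsElliptic] [W.IsGloballyMinimal]
    (hW : integralModelInt W = ⟨a1, a2, a3, a4, a6⟩) (ℓ n : ℕ) [Fact ℓ.Prime]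
    (hℓ3 : ℓ ≠ 3) (hℓΔ : ¬ (ℓ : ℤ) ∣ discOf [a1, a2, a3, a4, a6])
    (hcnt : Nat.card (((⟨a1, a2, a3, a4, a6⟩ : WeierstrassCurve ℤ).map
      (Int.castRingHom (ZMod ℓ))).toAffine.Point) = n)
    (hnoroot : ∀ t : ℕ, t < 3 → ¬ (3 : ℤ) ∣ (t : ℤ) ^ 2 - ((ℓ : ℤ) + 1 - n) * t + ℓ)
    (hr : W.analyticRank = 0) (hcard : Nat.card (W.selmerGroup (3 : ℤ)) = 9)
    (h9 : ∀ x : W.sha, 3 • x = 0 → x ≠ 0 → ∀ z : W.sha, 3 • z ≠ x)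
    {q : ℚ} (hq : shaAn W = (q : ℂ)) (hv : padicValRat 3 q = 2) : BSDp W 3 := by
  haveI : Fact (Nat.Prime 3) := ⟨by norm_num⟩
  have hΔ : (⟨a1, a2, a3, a4, a6⟩ : WeierstrassCurve ℤ).Δ = discOf [a1, a2, a3, a4, a6] :=
    intCurve_Δ a1 a2 a3 a4 a6
  have hirr : Irr W 3 := by
    refine hasIrreducibleModPGaloisRep_of_intModel_of_noroot hW 3 ℓ hℓ3 (by rw [hΔ]; exact hℓΔ) hcnt
      (forall_zmod_of_forall_lt fun t ht h0 ↦ hnoroot t ht ?_)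
    change ((3 : ℕ) : ℤ) ∣ _
    rw [← ZMod.intCast_zmod_eq_zero_iff_dvd]
    push_cast at h0 ⊢
    linear_combination h0
  exact bsdp_of_noDivisibleTorsion_of_card_selmerGroup W 3 hGZK hr
    (Supersingular.not_dvd_torsionOrder_of_irr W 3 hirr)
    (by rw [show (3 : ℕ) ^ 2 = 9 by norm_num]; exact hcard) h9 hq hv

/-- **The exact `3`-part under the same data, no analytic `Ш` value needed: `ord₃ #Ш(E/ℚ) = 2`**
(`#Ш(E/ℚ)[3^∞] = 9`). [cite: Creutz2014, Thm. 7.2] [cite: Mazur1978, §6 Prop. 6.3 (1) (p. 153)]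
[cite: SilvermanAEC2009, Thm X.4.2(a)] -/
theorem padicValNat_shaOrder_three_eq_two_of_ainvs_of_noDivisibleTorsion
    (hGZK : rank_eq_analyticRank_of_analyticRank_le_one)
    (a1 a2 a3 a4 a6 : ℤ) {W : WeierstrassCurve ℚ} [W.IsElliptic] [W.IsGloballyMinimal]
    (hW : integralModelInt W = ⟨a1, a2, a3, a4, a6⟩) (ℓ n : ℕ) [Fact ℓ.Prime]
    (hℓ3 : ℓ ≠ 3) (hℓΔ : ¬ (ℓ : ℤ) ∣ discOf [a1, a2, a3, a4, a6])
    (hcnt : Nat.card (((⟨a1, a2, a3, a4, a6⟩ : WeierstrassCurve ℤ).map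
      (Int.castRingHom (ZMod ℓ))).toAffine.Point) = n)
    (hnoroot : ∀ t : ℕ, t < 3 → ¬ (3 : ℤ) ∣ (t : ℤ) ^ 2 - ((ℓ : ℤ) + 1 - n) * t + ℓ)
    (hr : W.analyticRank = 0) (hcard : Nat.card (W.selmerGroup (3 : ℤ)) = 9)
    (h9 : ∀ x : W.sha, 3 • x = 0 → x ≠ 0 → ∀ z : W.sha, 3 • z ≠ x) :
    padicValNat 3 W.shaOrder = 2 := by
  haveI : Fact (Nat.Prime 3) := ⟨by norm_num⟩
  have hΔ : (⟨a1, a2, a3, a4, a6⟩ : WeierstrassCurve ℤ).Δ = discOf [a1, a2, a3, a4, a6] :=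
    intCurve_Δ a1 a2 a3 a4 a6
  have hirr : Irr W 3 := by
    refine hasIrreducibleModPGaloisRep_of_intModel_of_noroot hW 3 ℓ hℓ3 (by rw [hΔ]; exact hℓΔ) hcnt
      (forall_zmod_of_forall_lt fun t ht h0 ↦ hnoroot t ht ?_)
    change ((3 : ℕ) : ℤ) ∣ _
    rw [← ZMod.intCast_zmod_eq_zero_iff_dvd]
    push_cast at h0 ⊢
    linear_combination h0
  exact padicValNat_shaOrder_eq_of_noDivisibleTorsion_of_card_selmerGroup W 3 hGZK hr
    (Supersingular.not_dvd_torsionOrder_of_irr W 3 hirr)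
    (by rw [show (3 : ℕ) ^ 2 = 9 by norm_num]; exact hcard) h9

/-- **Discharging the typed missing input of `Typed/X10.lean`** at an X10 pair from the two certificates in
their PRINTED shape (`#Sel^(3) = 9`, the four second-descent emptiness documents). Bookkeeping.
[cite: Miller2011LMS, Def. 1.1] [cite: Creutz2014, Thm. 7.2] -/
theorem missingInputAt_of_noDivisibleTorsion_of_card_selmerThree
    (W : WeierstrassCurve ℚ) [W.IsElliptic] [W.IsGloballyMinimal]
    (hGZK : rank_eq_analyticRank_of_analyticRank_le_one) (hX : ClassX10 W 3)
    (hr : W.analyticRank = 0) (hcard : Nat.card (W.selmerGroup (3 : ℤ)) = 9)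
    (h9 : ∀ x : W.sha, 3 • x = 0 → x ≠ 0 → ∀ z : W.sha, 3 • z ≠ x)
    {q : ℚ} (hq : shaAn W = (q : ℂ)) (hv : padicValRat 3 q = 2) : X10.MissingInputAt W := fun _ =>
  haveI : Fact (Nat.Prime 3) := ⟨by norm_num⟩
  haveI : Finite W.sha := (hGZK W hX.analyticRank_le_one).2
  missingPPartAt_of_bsdp W 3
    (bsdp_of_noDivisibleTorsion_of_card_selmerGroup W 3 hGZK hr (not_three_dvd_torsionOrder_of_classX10 W hX)
      (by rw [show (3 : ℕ) ^ 2 = 9 by norm_num]; exact hcard) h9 hq hv)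

end Summit.BirchSwinnertonDyer.Rank1Residual.X10

end
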